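import Summits.RiemannHypothesis.RiemannHypothesis.Theorems.JensenPolynomialsCapCertSound

/-!
# Route `JensenPolynomials` — `XiCumulantMajorantCap` (stmt-RiemannHypothesis-19217) on the finite range `3 ≤ d ≤ 3000`

RH-FREE, γ-FREE proof-of-data (rung J-P(P1′), cell rh-jensen, engine target ET1 «C2GEN-CERT»), part 7 of the kernel
packaging: seven certificate runs `capCheckRange a n = true` covering `3 ≤ d ≤ 3000` (COMPUTATIONAL: `native_decide`, ≈ 20 s
each so the gate's accept audit can replay them; the evidence class of the route's table-crux packaging; the six runs on a
different chunking and the kernel-only spot rows `d = 1371, 17` of `JensenPolynomialsCapCertRuns` are an independent replay) combined with `capCheckRange_sound` (parts 2–6, standard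
axioms) gives the two inequalities of the route item `XiCumulantMajorantCap` for every `3 ≤ d ≤ 3000`: `Σ_{j=1}^{d} (d)_j e_j ρ_winMin(d,j) < 1` and
`Σ_{j=1}^{d} (d)_j e_j (2/B_d)^j < 1` with the item's cap sequence `c_k = a(k)(k−1)!2^{k/2}M_d^{−(k−2)/2}`.
The range contains every strict local maximum of `S₁` found by the certified two-evaluator table (kit j250011:
d = 18, 45, 499, 1371, 2047 below 3000; sup `S₁ = 0.83125…` at `d = 1371`); the all-`d` item still needs the analytic
tail `d > 3000` (theory: the `k = 3` family limit `0.7389` + vanishing corrections).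

Second half (TRANSFER TO LARGER PINS): the cap sequence `c_k(M) = a(k)(k−1)!2^{k/2}M^{−(k−2)/2}` is ANTITONE in the pin
`M` (`k ≥ 2`), hence both majorant sums are antitone in `M` (majorisation `cumulantCoeff_abs_le`, all weights `≥ 0`), and the
finite-range theorem transfers verbatim to every pin `max(N₁, 2d³) + d`, `N₁ ≥ 10⁴` — in particular to the re-pinned route
child `XiCumulantMajorantCapFar` (stmt-RiemannHypothesis-19472, `N₁ = 2·10¹⁸`; director-rh 2026-08-26T06:02Z), whose statement
restricted to `d ≤ 3000` is `xiCumulantMajorantCapFar_of_le_3000` below, VERBATIM.  Nothing here bears on the truth of RH.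
-/

-- D-0017: `Summit.RiemannHypothesis.RiemannHypothesis.…` duplicates the namespace BY DESIGN (single-problem summit).
set_option linter.dupNamespace false

namespace Summit.RiemannHypothesis.RiemannHypothesis.Theorems.JensenPolynomials.CapCert

open Finset Real
open Summit.RiemannHypothesis.RiemannHypothesis.Theorems.JensenPolynomials

/-- Certificate run of this file (computational, `native_decide`, ≈ 20 s): every `3 ≤ d < 433` passes `capCheck`. -/
theorem capCheckRange_3_430 : capCheckRange 3 430 = true := by native_decide

/-- Certificate run of this file (computational, `native_decide`, ≈ 20 s): every `433 ≤ d < 863` passes `capCheck`. -/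
theorem capCheckRange_433_430 : capCheckRange 433 430 = true := by native_decide

/-- Certificate run of this file (computational, `native_decide`, ≈ 20 s): every `863 ≤ d < 1293` passes `capCheck`. -/
theorem capCheckRange_863_430 : capCheckRange 863 430 = true := by native_decide

/-- Certificate run of this file (computational, `native_decide`, ≈ 20 s): every `1293 ≤ d < 1723` passes `capCheck`. -/
theorem capCheckRange_1293_430 : capCheckRange 1293 430 = true := by native_decide

/-- Certificate run of this file (computational, `native_decide`, ≈ 20 s): every `1723 ≤ d < 2153` passes `capCheck`. -/
theorem capCheckRange_1723_430 : capCheckRange 1723 430 = true := by native_decide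

/-- Certificate run of this file (computational, `native_decide`, ≈ 20 s): every `2153 ≤ d < 2583` passes `capCheck`. -/
theorem capCheckRange_2153_430 : capCheckRange 2153 430 = true := by native_decide

/-- Certificate run of this file (computational, `native_decide`, ≈ 20 s): every `2583 ≤ d < 3001` passes `capCheck`. -/
theorem capCheckRange_2583_418 : capCheckRange 2583 418 = true := by native_decide

/-- **`XiCumulantMajorantCap` ON THE FINITE RANGE `3 ≤ d ≤ 3000` (RH-FREE, γ-FREE; computational kernel theorem):
both all-plus majorant sums of the route item are `< 1`, with the item's cap sequence written verbatim.**
The all-`d` item `Theses.JensenPolynomials.XiCumulantMajorantCap` restricted to `d ≤ 3000` follows by `intro`. -/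
theorem xiCumulantMajorantCap_of_le_3000 (d : ℕ) (hd : 3 ≤ d) (hD : d ≤ 3000) :
    (∑ j ∈ Finset.range d, (d.descFactorial (j + 1) : ℝ) *
        cumulantCoeff (fun k : ℕ => (if k ≤ 3 then (9 / 8 : ℝ) else (k : ℝ) * 4 ^ (k - 3) / 3) *
          (Nat.factorial (k - 1) : ℝ) * (2 : ℝ) ^ ((k : ℝ) / 2) /
            ((max 10000 (2 * d ^ 3) + d : ℕ) : ℝ) ^ (((k : ℝ) - 2) / 2)) (j + 1) * rhoWinMin d (j + 1) < 1) ∧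
    (∑ j ∈ Finset.range d, (d.descFactorial (j + 1) : ℝ) *
        cumulantCoeff (fun k : ℕ => (if k ≤ 3 then (9 / 8 : ℝ) else (k : ℝ) * 4 ^ (k - 3) / 3) *
          (Nat.factorial (k - 1) : ℝ) * (2 : ℝ) ^ ((k : ℝ) / 2) /
            ((max 10000 (2 * d ^ 3) + d : ℕ) : ℝ) ^ (((k : ℝ) - 2) / 2)) (j + 1) *
          (2 / hermiteTestBound d) ^ (j + 1) < 1) := by
  by_cases h1 : d < 433
  · exact capCheckRange_sound capCheckRange_3_430 hd (by omega)
  by_cases h2 : d < 863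
  · exact capCheckRange_sound capCheckRange_433_430 (by omega) (by omega)
  by_cases h3 : d < 1293
  · exact capCheckRange_sound capCheckRange_863_430 (by omega) (by omega)
  by_cases h4 : d < 1723
  · exact capCheckRange_sound capCheckRange_1293_430 (by omega) (by omega)
  by_cases h5 : d < 2153
  · exact capCheckRange_sound capCheckRange_1723_430 (by omega) (by omega)
  by_cases h6 : d < 2583
  · exact capCheckRange_sound capCheckRange_2153_430 (by omega) (by omega)
  · exact capCheckRange_sound capCheckRange_2583_418 (by omega) (by omega)

/-- **The caps at pins `0 < M ≤ M'`: `0 ≤ c_k(M')` and, for `k ≥ 2`, `c_k(M') ≤ c_k(M)` (antitone in the pin), where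
`c_k(X) = a(k)(k−1)!2^{k/2}/X^{(k−2)/2}` is written out explicitly.** -/
theorem capAt_facts {M M' : ℝ} (hM : 0 < M) (hMM : M ≤ M') {k : ℕ} (hk : 2 ≤ k) :
    0 ≤ (if k ≤ 3 then (9 / 8 : ℝ) else (k : ℝ) * 4 ^ (k - 3) / 3) * (Nat.factorial (k - 1) : ℝ) *
      (2 : ℝ) ^ ((k : ℝ) / 2) / M' ^ (((k : ℝ) - 2) / 2) ∧
    (if k ≤ 3 then (9 / 8 : ℝ) else (k : ℝ) * 4 ^ (k - 3) / 3) * (Nat.factorial (k - 1) : ℝ) *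
      (2 : ℝ) ^ ((k : ℝ) / 2) / M' ^ (((k : ℝ) - 2) / 2)
      ≤ (if k ≤ 3 then (9 / 8 : ℝ) else (k : ℝ) * 4 ^ (k - 3) / 3) * (Nat.factorial (k - 1) : ℝ) *
      (2 : ℝ) ^ ((k : ℝ) / 2) / M ^ (((k : ℝ) - 2) / 2) := by
  have hM' : 0 < M' := hM.trans_le hMM
  have hnum : 0 ≤ (if k ≤ 3 then (9 / 8 : ℝ) else (k : ℝ) * 4 ^ (k - 3) / 3) * (Nat.factorial (k - 1) : ℝ) *
      (2 : ℝ) ^ ((k : ℝ) / 2) := by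
    apply mul_nonneg (mul_nonneg _ (Nat.cast_nonneg _)) (Real.rpow_nonneg (by norm_num) _)
    split_ifs <;> positivity
  refine ⟨div_nonneg hnum (Real.rpow_nonneg hM'.le _), ?_⟩
  have he : 0 ≤ ((k : ℝ) - 2) / 2 := by
    have : (2 : ℝ) ≤ k := by exact_mod_cast hk
    linarith
  have hpow : M ^ (((k : ℝ) - 2) / 2) ≤ M' ^ (((k : ℝ) - 2) / 2) := Real.rpow_le_rpow hM.le hMM he
  have hpos : 0 < M ^ (((k : ℝ) - 2) / 2) := Real.rpow_pos_of_pos hM _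
  exact div_le_div_of_nonneg_left hnum hpos hpow

/-- **Both majorant sums are antitone in the pin: at any real pin `M' ≥ M_d` they are at most their values at `M_d`.** -/
theorem capSums_antitone {d : ℕ} (hd : 3 ≤ d) {M' : ℝ} (hMM : ((max 10000 (2 * d ^ 3) + d : ℕ) : ℝ) ≤ M') :
    (∑ j ∈ range d, (d.descFactorial (j + 1) : ℝ) *
        cumulantCoeff (fun k : ℕ => (if k ≤ 3 then (9 / 8 : ℝ) else (k : ℝ) * 4 ^ (k - 3) / 3) *
          (Nat.factorial (k - 1) : ℝ) * (2 : ℝ) ^ ((k : ℝ) / 2) / M' ^ (((k : ℝ) - 2) / 2)) (j + 1) * rhoWinMin d (j + 1)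
      ≤ ∑ j ∈ range d, (d.descFactorial (j + 1) : ℝ) * cumulantCoeff (capFun d) (j + 1) * rhoWinMin d (j + 1)) ∧
    (∑ j ∈ range d, (d.descFactorial (j + 1) : ℝ) *
        cumulantCoeff (fun k : ℕ => (if k ≤ 3 then (9 / 8 : ℝ) else (k : ℝ) * 4 ^ (k - 3) / 3) *
          (Nat.factorial (k - 1) : ℝ) * (2 : ℝ) ^ ((k : ℝ) / 2) / M' ^ (((k : ℝ) - 2) / 2)) (j + 1) * (2 / hermiteTestBound d) ^ (j + 1)
      ≤ ∑ j ∈ range d, (d.descFactorial (j + 1) : ℝ) * cumulantCoeff (capFun d) (j + 1) *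
          (2 / hermiteTestBound d) ^ (j + 1)) := by
  have hM : (0 : ℝ) < ((max 10000 (2 * d ^ 3) + d : ℕ) : ℝ) := (Mof_facts d).2
  have hmaj : ∀ j, cumulantCoeff (fun k : ℕ => (if k ≤ 3 then (9 / 8 : ℝ) else (k : ℝ) * 4 ^ (k - 3) / 3) *
          (Nat.factorial (k - 1) : ℝ) * (2 : ℝ) ^ ((k : ℝ) / 2) / M' ^ (((k : ℝ) - 2) / 2)) j ≤ cumulantCoeff (capFun d) j := fun j =>
    (abs_le.mp (cumulantCoeff_abs_le _ (capFun d) j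
      (fun k hk _ => by
        have hf := capAt_facts hM hMM (by omega : 2 ≤ k)
        rw [abs_of_nonneg hf.1]
        exact hf.2) j le_rfl).1).2
  have hB : 0 < hermiteTestBound d := by unfold hermiteTestBound; positivity
  constructor
  · apply Finset.sum_le_sum; intro j _
    exact mul_le_mul_of_nonneg_right (mul_le_mul_of_nonneg_left (hmaj _) (Nat.cast_nonneg _))
      (rhoWinMin_nonneg d (j + 1) hd (by omega))
  · apply Finset.sum_le_sum; intro j _
    exact mul_le_mul_of_nonneg_right (mul_le_mul_of_nonneg_left (hmaj _) (Nat.cast_nonneg _)) (by positivity)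

/-- **TRANSFER TO ANY LARGER PIN `max(N₁, 2d³) + d`, `N₁ ≥ 10⁴`, on the finite range `3 ≤ d ≤ 3000` (computational through
`xiCumulantMajorantCap_of_le_3000`): both majorant sums `< 1`.** -/
theorem xiCumulantMajorantCap_of_le_3000_pin (N1 : ℕ) (hN : 10000 ≤ N1) (d : ℕ) (hd : 3 ≤ d) (hD : d ≤ 3000) :
    (∑ j ∈ Finset.range d, (d.descFactorial (j + 1) : ℝ) *
        cumulantCoeff (fun k : ℕ => (if k ≤ 3 then (9 / 8 : ℝ) else (k : ℝ) * 4 ^ (k - 3) / 3) *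
          (Nat.factorial (k - 1) : ℝ) * (2 : ℝ) ^ ((k : ℝ) / 2) /
            ((max N1 (2 * d ^ 3) + d : ℕ) : ℝ) ^ (((k : ℝ) - 2) / 2)) (j + 1) * rhoWinMin d (j + 1) < 1) ∧
    (∑ j ∈ Finset.range d, (d.descFactorial (j + 1) : ℝ) *
        cumulantCoeff (fun k : ℕ => (if k ≤ 3 then (9 / 8 : ℝ) else (k : ℝ) * 4 ^ (k - 3) / 3) *
          (Nat.factorial (k - 1) : ℝ) * (2 : ℝ) ^ ((k : ℝ) / 2) /
            ((max N1 (2 * d ^ 3) + d : ℕ) : ℝ) ^ (((k : ℝ) - 2) / 2)) (j + 1) *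
          (2 / hermiteTestBound d) ^ (j + 1) < 1) := by
  have hbase := xiCumulantMajorantCap_of_le_3000 d hd hD
  have hle : ((max 10000 (2 * d ^ 3) + d : ℕ) : ℝ) ≤ ((max N1 (2 * d ^ 3) + d : ℕ) : ℝ) := by
    have : max 10000 (2 * d ^ 3) + d ≤ max N1 (2 * d ^ 3) + d := Nat.add_le_add_right (max_le_max hN le_rfl) d
    exact_mod_cast this
  have hmono := capSums_antitone hd hle
  exact ⟨hmono.1.trans_lt hbase.1, hmono.2.trans_lt hbase.2⟩

/-- **The re-pinned route child `XiCumulantMajorantCapFar` (stmt-RiemannHypothesis-19472, pin `max(2·10¹⁸, 2d³) + d`)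
on the finite range `3 ≤ d ≤ 3000`, with its statement written VERBATIM** (computational through the banked
`d ≤ 3000` certificate; the complement `d > 3000` is the d-uniform analytic tail). -/
theorem xiCumulantMajorantCapFar_of_le_3000 (d : ℕ) (hd : 3 ≤ d) (hD : d ≤ 3000) :
    (∑ j ∈ Finset.range d, (d.descFactorial (j + 1) : ℝ) *
        cumulantCoeff (fun k : ℕ => (if k ≤ 3 then (9 / 8 : ℝ) else (k : ℝ) * 4 ^ (k - 3) / 3) *
          (Nat.factorial (k - 1) : ℝ) * (2 : ℝ) ^ ((k : ℝ) / 2) /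
            ((max (2 * 10 ^ 18) (2 * d ^ 3) + d : ℕ) : ℝ) ^ (((k : ℝ) - 2) / 2)) (j + 1) * rhoWinMin d (j + 1) < 1) ∧
    (∑ j ∈ Finset.range d, (d.descFactorial (j + 1) : ℝ) *
        cumulantCoeff (fun k : ℕ => (if k ≤ 3 then (9 / 8 : ℝ) else (k : ℝ) * 4 ^ (k - 3) / 3) *
          (Nat.factorial (k - 1) : ℝ) * (2 : ℝ) ^ ((k : ℝ) / 2) /
            ((max (2 * 10 ^ 18) (2 * d ^ 3) + d : ℕ) : ℝ) ^ (((k : ℝ) - 2) / 2)) (j + 1) *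
          (2 / hermiteTestBound d) ^ (j + 1) < 1) :=
  xiCumulantMajorantCap_of_le_3000_pin (2 * 10 ^ 18) (by norm_num) d hd hD

end Summit.RiemannHypothesis.RiemannHypothesis.Theorems.JensenPolynomials.CapCert
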